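import Summits.PneNP.PneNP.Theorems.SymmetryBudgetNoHiddenOrderProgramRankC

/-!
# `NoHiddenOrder` (stmt-PneNP-14781), (R2c) VI: the window canoniser program — ranks IV: `rank_lt` and the program

Route `PneNP/SymmetryBudget`; continues `SymmetryBudgetNoHiddenOrderProgramRankC.lean`.  Every source of every gate is `Pre` at the
gate's coordinates (`pre_srcs`, dispatching to the shape lemmas), hence has smaller rank (`rank_lt`); this makes `kind`, `srcs`, `rank` a
symmetric threshold PROGRAM **`prog m : SymProg (Fin m × Fin m) (Gt m)`** in the sense of the kit.  Supports stmt-PneNP-14781.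
-/

set_option linter.dupNamespace false -- `Summit.PneNP.PneNP.…` (D-0017 single-conjunct layout)

namespace Summit.PneNP.PneNP.Theorems

open Finset CGBits BranchSum Literature.Computability.Complexity Literature.Computability.Complexity.SymProg

namespace WCanon.R2c

variable {m : ℕ}

/-- Signature wires are inputs or the constant `ff`. -/
theorem pre_sigW (u : WV m) (j : Fin (m + m)) {lv : ℕ} (hlv : 1 ≤ lv) : Pre 0 0 0 lv (sigW u j) := by
  unfold sigW sigWire
  split_ifs <;> first | exact pre_inl _ | exact pre_gate rfl rfl rfl (by simp only [lvl]; omega)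

/-- **Every source of a gate is `Pre` at the gate's coordinates.** [folklore] -/
theorem pre_srcs (l : Gt m) : ∀ w ∈ srcs l, Pre (tier l) (ms l) (blk l) (lvl l) w := by
  cases l with
  | tt => simp [srcs]
  | ff => simp [srcs]
  | adjW u v =>
    simp only [srcs]
    split_ifs
    · simp
    · simp only [Finset.forall_mem_insert, Finset.mem_singleton, forall_eq]; exact ⟨pre_inl _, pre_inl _⟩
  | adjO u b =>
    simp only [srcs]
    split_ifs
    · simp
    · simp only [Finset.forall_mem_insert, Finset.mem_singleton, forall_eq]; exact ⟨pre_inl _, pre_inl _⟩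
  | sig g =>
    simp only [srcs, tier, ms, blk, lvl]
    exact pre_vsSrcs (bw := sigW) (e := Gt.sig) (t := 0) (s := 0) (b := 0) (base := 1) (fun k j => pre_sigW k j le_rfl)
      (fun g' => pre_gate rfl rfl rfl (by simp only [lvl]; omega)) g
  | root g =>
    simp only [srcs, tier, ms, blk, lvl]
    exact pre_riSrcs (ι := rootIn m) (e := Gt.root) (t := 0) (s := 0) (b := 0) (base := 5) (fun v => pre_gate rfl rfl rfl (by simp [lvl]))
      (fun u v => pre_gate rfl rfl rfl (by simp [lvl])) (fun u v => pre_gate rfl rfl rfl (by simp [lvl, vsLvl]))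
      (fun u v => pre_gate rfl rfl rfl (by simp [lvl, vsLvl])) (fun g' => pre_gate rfl rfl rfl (by simp only [lvl]; omega)) g
  | an L k g =>
    simp only [srcs, tier, ms, blk, lvl]
    have h := pre_anSrcs (L := L) (ι := stIn L k) (e := Gt.an L k) (t := 1) (s := msL L) (b := 2 * k) (base := 0)
      (fun v => pre_memW L k v le_rfl) (fun v c => pre_valW L k v c le_rfl) (fun v => pre_consW L k v le_rfl) (pre_deadW L k le_rfl)
      (fun u v => pre_adjWire u v) (fun g' => pre_gate rfl rfl rfl (by simp only [lvl]; omega)) g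
    simpa only [Nat.zero_add] using h
  | tr L k g =>
    simp only [srcs, tier, ms, blk, lvl]
    have hk : 2 * ((k.castSucc : Fin (pF m + 1)) : ℕ) ≤ 2 * (k : ℕ) + 1 := by simp
    have h := pre_trSrcs (L := L) (σ := stIn L k.castSucc) (ea := Gt.an L k.castSucc) (e := Gt.tr L k) (t := 1) (s := msL L)
      (b := 2 * k + 1) (base := 0)
      (fun v => pre_memW L _ v hk) (fun v c => pre_valW L _ v c hk) (fun v => pre_consW L _ v hk) (pre_deadW L _ hk)
      (fun u v => pre_adjWire u v) (fun g' => pre_an L _ g' (by simp)) (fun g' => pre_gate rfl rfl rfl (by simp only [lvl]; omega)) g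
    simpa only [Nat.zero_add] using h
  | vor L g => exact pre_orSrcs L g
  | vand L g => exact pre_andSrcs L g
  | vl L g => exact pre_vlSrcs L g
  | woc a b u c =>
    simp only [srcs, Finset.forall_mem_insert, Finset.mem_singleton, forall_eq]
    exact ⟨pre_tier (by simp [tier]), pre_tier (by simp [tier]), pre_tier (by simp [tier])⟩
  | out q =>
    simp only [srcs]
    split_ifs
    · simp only [Finset.mem_singleton, forall_eq]; exact pre_tier (by simp [tier])
    · simp only [Finset.forall_mem_image, Finset.mem_univ, true_imp_iff]; exact fun uc => pre_tier (by simp [tier])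
    · simp only [Finset.forall_mem_image, Finset.mem_univ, true_imp_iff]; exact fun uc => pre_tier (by simp [tier])
    · simp
    · simp only [Finset.forall_mem_insert, Finset.mem_singleton, forall_eq]; exact ⟨pre_inl _, pre_inl _⟩

/-- **Sources have smaller rank.** [folklore] -/
theorem rank_lt : ∀ l l' : Gt m, Sum.inr l' ∈ srcs l → rank l' < rank l := fun l _ h => rank_lt_of_pre (pre_srcs l _ h) rfl

variable (m) in
/-- **The window canoniser program at size `m`** (symmetric threshold program over the input matrix `Fin m × Fin m`). [folklore] -/
noncomputable def prog : SymProg (Fin m × Fin m) (Gt m) where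
  kind := kind
  srcs := srcs
  rank := rank
  rank_lt := rank_lt

end WCanon.R2c

end Summit.PneNP.PneNP.Theorems
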